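import Literature.AnabelianGeometry.EtaleTheta.Discharge.Sec5Prop52AtTowerLevels
import Literature.AnabelianGeometry.EtaleTheta.Discharge.Sec5OfThetaSetting

/-!
# [EtTh] Prop. 5.2 (ii)/(iii) p.324, Rmk. 4.3.2 pp.318–319, §5 pp.330–331 (PDF pp.98, 92–93, 104–105): the rows `StrvSection` (F-0555), `ThetaPairActionsAgree` (F-0556), `ThetaPairKummerClass` (F-0558) at every level of the §5 TOWER OF THE §1 SETTING

Mochizuki, *The étale theta function and its Frobenioid-theoretic manifestations*, Publ. RIMS **45** (2009)
[cite: MochizukiEtTh2009, Prop 5.2 p.324 (PDF p.98); Rmk 4.3.2 p.318–319 (PDF pp.92–93); §5 p.322 (PDF p.96); §5 p.330–331 (PDF pp.104–105)].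
abc-iut cell, block F (FACT-PROVING wave, batch 2), seat abc-iut-f-126 (gen 5; tranche 126 = FACT-LIST rows **F-0555**
`ThetaFrobenioid.StrvSection`, **F-0556** `FrobenioidThetaBiKummer.ThetaPairActionsAgree`, **F-0558**
`FrobenioidThetaBiKummer.ThetaPairKummerClass`, trunk `FrobenioidThetaBiKummer.lean`).  PROOF-ONLY companion of this seat's
`Discharge/Sec5Prop52AtThetaSetting.lean` (one-level data of the Setting) and sequel of `Discharge/Sec5Prop52AtTowerLevels.lean` (p436587; the
rows at every level of `ofConnectedTemperoidFamily` / the `Ÿ`-tower for FREE `(X, 𝒯, ιX)`): no `def`, no `Prop` fact, no instance; nothing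
landed is edited or restated — every conjunct that already has a name is CITED.

WHAT IS NEW HERE — the rows at EVERY level `N ≥ 1` of the tower of §5 data that pins `(X, 𝒯, ιX)` to the §1 Setting (abc-iut-L2-t4, ROW
W3-L2-01, `Discharge/Sec5OfThetaSetting.lean`: **`ThetaFrobenioidTower.ofThetaSettingFamily`** over abc-iut-L2-t8's projective system of §2 data
`C.thetaEnvTower τ hC hS` (`TowerOfSetting.lean`), `X := Π^tp_X̲̲ = C.Huu`, `ιX := id`; Rmk. 4.3.2 "by allowing `N` to vary … compatible
systems"):
* `thetaPairActionsAgree_atLevel_ofThetaSettingFamily_iff` — Prop. 5.2 (ii) (F-0556) as a characterisation, UNCONDITIONAL;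
* `prop52Rows_atLevel_ofThetaSettingFamily` — `StrvSection ∧ (A_N Aut-ample) ∧ (∀ ν, ∃ η, ThetaPairKummerClass η ν)` MODULO THE SINGLE
  PRINTED INPUT `hH` (`Π^tp_Ÿ̲̲ ⊆ H_⊙`, §5 p.322), for any Frobenius-trivial Galois `A_⊙`;
* `prop52Rows_atLevel_ofThetaSettingYddTower` — the same with `A_⊙^bs := Ÿ̲̲` (`BiKummerSetting.mkOfConnectedTemperoidYddTower` at
  `(Π^tp_X̲̲, C.thetaEnvTower τ hC hS, id)`, `hH :=` abc-iut-L2-t4's THEOREM `hH_mkOfConnectedTemperoidYddTower`): NO named `Π`-side input.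
The levels `M ∈ E` ARE the one-level data `ThetaFrobenioid.ofThetaSettingData (τ.mod M)` (abc-iut-L2-t4's `atLevel_ofThetaSettingFamily_eq`,
`rfl`), whose rows are in the companion file.

Every proof is a citation: `ofThetaSettingFamily` IS `ofConnectedTemperoidFamily` at `(Π^tp_X̲̲, C.thetaEnvTower τ hC hS, id)` (abc-iut-L2-t4's
`ofThetaSettingFamily_eq`, `rfl`), so this seat's `thetaPairActionsAgree_atLevel_ofConnectedTemperoidFamily_iff` /
`prop52Rows_atLevel_ofConnectedTemperoidFamily` / `prop52Rows_atLevel_ofConnectedTemperoidYddTower` (F-0555 = abc-iut-L2-t4's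
`strvSection_levelData`, `hσ := baseMap_strvOfBiKummerData`; F-0558 ⟸ Prop. 4.3 (iii) `biKummerDifferenceMem_levelData` with `hfrac` / `haut`
the identity-dictionary theorems; witness `η := ν⁻¹ ∘ (s^⊓-gp_N · (s^⊔-gp_N)⁻¹)`, `u := 1` — the PINNED `η` of print, MERGE-PLAN row 6, is NOT
claimed; F-0556 ⟸ total epimorphicity = [FrdI] Thm. 5.2, `epi_of_model`, abc-iut-w6-d086) apply verbatim.
RESIDUAL INPUTS (each printed; none a Prop-valued definition; none a FACT-LIST name): the tempered Frobenioid `tf` of Ex. 3.9 over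
`B^temp(Π^tp_X̲̲)⁰` (Def. 3.6 (ii) DATA), `h` ([FrdI] Thm. 5.2 hypotheses of the model), `Q`, the roots `Rl` / `R N`, the constants
`K', constEmb N`, the divisor invariances `hinvc` (p.330) / `hinvp` (Prop. 4.3 (i) proof, p.317), the Rmk. 4.3.2 transitions `α, β` with their
squares / isometry / degree / base-Frobenius clauses; Setting side `e`, `hC : Compat`, `hS : Sec2Hyps`, `τ : CyclotomeTower`.
HONEST FRAMING: kernel-checked consequences for data so constructed; the parameter `tf` is NOT shown inhabited for the curve; nothing of
[EtTh] (a refereed paper) is asserted unconditionally; a FACT row is an assumption label, not an endorsement; nothing here bears on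
[IUTchIII] Cor. 3.12; no side is taken; typed ≠ proved.
-/

noncomputable section

namespace Literature.AnabelianGeometry.EtaleTheta

open CategoryTheory Opposite Literature.AlgebraicGeometry.Frobenioids Literature.AnabelianGeometry.SemiGraphs
  Literature.AnabelianGeometry.SemiGraphs.GaloisObjects Literature.AlgebraicGeometry.Frobenioids.QuasiTemperoid.BTempConnected

universe v₀

/-! ### At every level of the tower of the Setting (`ThetaFrobenioidTower.ofThetaSettingFamily`, Rmk. 4.3.2) -/

namespace ThetaFrobenioidTower

section OfThetaSettingFamily

variable {p : ℕ} [Fact p.Prime] {D : ThetaSetting p} {E : D.EtaleThetaData} {l : ℕ} {C : E.DoubleUnderline l}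
  {e : D.toTemperedCurve.GroupLevelData} {Es : Set ℕ+} (τ : D.CyclotomeTower l Es) (hC : D.Compat) (hS : D.Sec2Hyps)
  {D₀ : Type} [Category.{v₀} D₀] {V : FrdIMonoidStub.{0}} {T₀ : RealifiedDivisorMonoids (D₀ := D₀) V}
  {VD : FrdICatStub.{1, 0, 0} (ConnectedPart (BTemp (C.temperedArithmeticGroup e).Pi))}
  {tf : TemperedFrobenioid T₀ (ConnectedPart (BTemp (C.temperedArithmeticGroup e).Pi)) VD} {hZ : tf.monoidType = MonoidType.Z}
  {hP : ∀ A : (ConnectedPart (BTemp (C.temperedArithmeticGroup e).Pi))ᵒᵖ, IsPerfect (tf.Φ.carrier A)}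
  {NH : Subgroup (Field.absoluteGaloisGroup D.K) → tf.category → ℕ+ → Prop} {A₀ : tf.category}
  {hA₀ : PreFrobenioid.IsFrobeniusTrivial tf.toElem A₀} {hA₀' : SemiGraphs.IsGaloisObj A₀.base.obj}
  {pullFrac : ∀ {A A' : (BiKummerSetting.mkOfConnectedTemperoid (C.temperedArithmeticGroup e) tf hZ hP NH A₀ hA₀ hA₀').C} (_ : A' ⟶ A),
    (BiKummerSetting.mkOfConnectedTemperoid (C.temperedArithmeticGroup e) tf hZ hP NH A₀ hA₀ hA₀').biratUnits A →
      (BiKummerSetting.mkOfConnectedTemperoid (C.temperedArithmeticGroup e) tf hZ hP NH A₀ hA₀ hA₀').biratUnits A'}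
  {θ : (BiKummerSetting.mkOfConnectedTemperoid (C.temperedArithmeticGroup e) tf hZ hP NH A₀ hA₀ hA₀').biratUnits
    (BiKummerSetting.mkOfConnectedTemperoid (C.temperedArithmeticGroup e) tf hZ hP NH A₀ hA₀ hA₀').Aodot}
  {Bl : (BiKummerSetting.mkOfConnectedTemperoid (C.temperedArithmeticGroup e) tf hZ hP NH A₀ hA₀ hA₀').C}
  {Pl : (BiKummerSetting.mkOfConnectedTemperoid (C.temperedArithmeticGroup e) tf hZ hP NH A₀ hA₀ hA₀').FractionPair θ Bl}
  {Rl : (BiKummerSetting.mkOfConnectedTemperoid (C.temperedArithmeticGroup e) tf hZ hP NH A₀ hA₀ hA₀').NthRoot θ Pl C.lPNat pullFrac}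
  (h : ModelFrobenioid.Hypotheses tf.divisorMonoid tf.ratFnFunctor)
  (Q : FrobenioidTheta.ThetaSubquotientStub.{0} (ConnectedPart (BTemp (C.temperedArithmeticGroup e).Pi)))
  (R : ∀ N : ℕ+, (BiKummerSetting.mkOfConnectedTemperoid (C.temperedArithmeticGroup e) tf hZ hP NH A₀ hA₀ hA₀').NthRoot Rl.root Rl.pair N pullFrac)
  (K' : Type) [Field K'] (constEmb : ∀ N : ℕ+, K'ˣ →* tf.biratUnitsModel (R N).BN)
  (constEmb_injective : ∀ N : ℕ+, Function.Injective (constEmb N))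
  (hinvc : ∀ (N : ℕ+) (g : Aut (R N).AN.base),
    pull tf.divisorMonoid g.hom (ModelFrobenioid.div (R N).pair.num) = ModelFrobenioid.div (R N).pair.num)
  (hinvp : ∀ (N : ℕ+) (y : (C.thetaEnvTower τ hC hS).PiX), y ∈ (C.thetaEnvTower τ hC hS).PiYdd →
    pull tf.divisorMonoid ((BiKummerSetting.mkOfConnectedTemperoid (C.temperedArithmeticGroup e) tf hZ hP NH A₀ hA₀ hA₀').galoisSurj
      (R N).AN.base (R N).αData.isGalois ((ContinuousMulEquiv.refl _) y)).hom (ModelFrobenioid.div (R N).pair.den) =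
        ModelFrobenioid.div (R N).pair.den)
  (α : ∀ {N N' : ℕ+}, (N : ℕ) ∣ N' → ((R N').AN ⟶ (R N).AN))
  (β : ∀ {N N' : ℕ+}, (N : ℕ) ∣ N' → ((R N').BN ⟶ (R N).BN))
  (comm_sCap : ∀ {N N' : ℕ+} (hd : (N : ℕ) ∣ N'), (R N').pair.num ≫ β hd = α hd ≫ (R N).pair.num)
  (comm_sCup : ∀ {N N' : ℕ+} (hd : (N : ℕ) ∣ N'), (R N').pair.den ≫ β hd = α hd ≫ (R N).pair.den)
  (isIsometry_α : ∀ {N N' : ℕ+} (hd : (N : ℕ) ∣ N'),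
    ((BiKummerSetting.mkOfConnectedTemperoid (C.temperedArithmeticGroup e) tf hZ hP NH A₀ hA₀ hA₀').sec5Stub h).pre.IsIsometry (α hd))
  (degFr_α : ∀ {N N' : ℕ+} (hd : (N : ℕ) ∣ N'),
    (((BiKummerSetting.mkOfConnectedTemperoid (C.temperedArithmeticGroup e) tf hZ hP NH A₀ hA₀ hA₀').sec5Stub h).pre.degFr (α hd) : ℕ) *
      N = N')
  (isIsometry_β : ∀ {N N' : ℕ+} (hd : (N : ℕ) ∣ N'),
    ((BiKummerSetting.mkOfConnectedTemperoid (C.temperedArithmeticGroup e) tf hZ hP NH A₀ hA₀ hA₀').sec5Stub h).pre.IsIsometry (β hd))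
  (degFr_β : ∀ {N N' : ℕ+} (hd : (N : ℕ) ∣ N'),
    (((BiKummerSetting.mkOfConnectedTemperoid (C.temperedArithmeticGroup e) tf hZ hP NH A₀ hA₀ hA₀').sec5Stub h).pre.degFr (β hd) : ℕ) *
      N = N')
  (baseFrob_α : ∀ {N N' : ℕ+} (hd : (N : ℕ) ∣ N'),
    (BiKummerSetting.mkOfConnectedTemperoid (C.temperedArithmeticGroup e) tf hZ hP NH A₀ hA₀ hA₀').IsOfBaseFrobeniusType (α hd))

/-- **[EtTh] Prop. 5.2 (ii) (F-0556) at EVERY level `N ≥ 1` of the tower of the Setting, as a characterisation, UNCONDITIONAL**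
(`ofThetaSettingFamily` IS `ofConnectedTemperoidFamily` at `(Π^tp_X̲̲, C.thetaEnvTower τ hC hS, id)`; this seat's
`thetaPairActionsAgree_atLevel_ofConnectedTemperoidFamily_iff`).  [cite: MochizukiEtTh2009, Prop 5.2 (ii) p.324 (PDF p.98); Rmk 4.3.2 p.318–319 (PDF pp.92–93); §5 p.331 (PDF p.105)] -/
theorem thetaPairActionsAgree_atLevel_ofThetaSettingFamily_iff (N : ℕ+)
    (actS actT : ((ofThetaSettingFamily τ hC hS h Q R K' constEmb constEmb_injective hinvc hinvp α β comm_sCap comm_sCup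
        isIsometry_α degFr_α isIsometry_β degFr_β baseFrob_α).atLevel N).HB →*
      Aut ((ofThetaSettingFamily τ hC hS h Q R K' constEmb constEmb_injective hinvc hinvp α β comm_sCap comm_sCup
        isIsometry_α degFr_α isIsometry_β degFr_β baseFrob_α).atLevel N).BN) :
    FrobenioidThetaBiKummer.ThetaPairActionsAgree
        ((ofThetaSettingFamily τ hC hS h Q R K' constEmb constEmb_injective hinvc hinvp α β comm_sCap comm_sCup
          isIsometry_α degFr_α isIsometry_β degFr_β baseFrob_α).atLevel N) actS actT ↔
      (∀ hh : ((ofThetaSettingFamily τ hC hS h Q R K' constEmb constEmb_injective hinvc hinvp α β comm_sCap comm_sCup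
            isIsometry_α degFr_α isIsometry_β degFr_β baseFrob_α).atLevel N).HB,
          ((ofThetaSettingFamily τ hC hS h Q R K' constEmb constEmb_injective hinvc hinvp α β comm_sCap comm_sCup
              isIsometry_α degFr_α isIsometry_β degFr_β baseFrob_α).atLevel N).sCap ≫ (actS hh).hom =
            (((ofThetaSettingFamily τ hC hS h Q R K' constEmb constEmb_injective hinvc hinvp α β comm_sCap comm_sCup
                isIsometry_α degFr_α isIsometry_β degFr_β baseFrob_α).atLevel N).strv
              (((ofThetaSettingFamily τ hC hS h Q R K' constEmb constEmb_injective hinvc hinvp α β comm_sCap comm_sCup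
                  isIsometry_α degFr_α isIsometry_β degFr_β baseFrob_α).atLevel N).autBaseIsoAB.symm
                (hh : Aut (((ofThetaSettingFamily τ hC hS h Q R K' constEmb constEmb_injective hinvc hinvp α β comm_sCap
                    comm_sCup isIsometry_α degFr_α isIsometry_β degFr_β baseFrob_α).atLevel N).base.obj
                  ((ofThetaSettingFamily τ hC hS h Q R K' constEmb constEmb_injective hinvc hinvp α β comm_sCap comm_sCup
                    isIsometry_α degFr_α isIsometry_β degFr_β baseFrob_α).atLevel N).BN)))).hom ≫
              ((ofThetaSettingFamily τ hC hS h Q R K' constEmb constEmb_injective hinvc hinvp α β comm_sCap comm_sCup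
                isIsometry_α degFr_α isIsometry_β degFr_β baseFrob_α).atLevel N).sCap) ∧
        ∀ hh : ((ofThetaSettingFamily τ hC hS h Q R K' constEmb constEmb_injective hinvc hinvp α β comm_sCap comm_sCup
            isIsometry_α degFr_α isIsometry_β degFr_β baseFrob_α).atLevel N).HB,
          ((ofThetaSettingFamily τ hC hS h Q R K' constEmb constEmb_injective hinvc hinvp α β comm_sCap comm_sCup
              isIsometry_α degFr_α isIsometry_β degFr_β baseFrob_α).atLevel N).sCup ≫ (actT hh).hom =
            (((ofThetaSettingFamily τ hC hS h Q R K' constEmb constEmb_injective hinvc hinvp α β comm_sCap comm_sCup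
                isIsometry_α degFr_α isIsometry_β degFr_β baseFrob_α).atLevel N).strv
              (((ofThetaSettingFamily τ hC hS h Q R K' constEmb constEmb_injective hinvc hinvp α β comm_sCap comm_sCup
                  isIsometry_α degFr_α isIsometry_β degFr_β baseFrob_α).atLevel N).autBaseIsoAB.symm
                (hh : Aut (((ofThetaSettingFamily τ hC hS h Q R K' constEmb constEmb_injective hinvc hinvp α β comm_sCap
                    comm_sCup isIsometry_α degFr_α isIsometry_β degFr_β baseFrob_α).atLevel N).base.obj
                  ((ofThetaSettingFamily τ hC hS h Q R K' constEmb constEmb_injective hinvc hinvp α β comm_sCap comm_sCup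
                    isIsometry_α degFr_α isIsometry_β degFr_β baseFrob_α).atLevel N).BN)))).hom ≫
              ((ofThetaSettingFamily τ hC hS h Q R K' constEmb constEmb_injective hinvc hinvp α β comm_sCap comm_sCup
                isIsometry_α degFr_α isIsometry_β degFr_β baseFrob_α).atLevel N).sCup :=
  thetaPairActionsAgree_atLevel_ofConnectedTemperoidFamily_iff (𝒯 := C.thetaEnvTower τ hC hS) h Q C.odd_lPNat R
    (ContinuousMulEquiv.refl _) K' constEmb constEmb_injective hinvc hinvp α β comm_sCap comm_sCup isIsometry_α degFr_α isIsometry_β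
    degFr_β baseFrob_α N actS actT

/-- **Tranche-126 certificate at EVERY level `N ≥ 1` of the tower of the Setting MODULO `hH`** (`Π^tp_Ÿ̲̲ ⊆ H_⊙`): F-0555 `StrvSection`,
"`A_N` is Aut-ample", F-0558 (`η`-existential, every `ν`) — this seat's `prop52Rows_atLevel_ofConnectedTemperoidFamily` read at
`(Π^tp_X̲̲, C.thetaEnvTower τ hC hS, id)` (`hσ` / `hfrac` / `haut` are THEOREMS there).
[cite: MochizukiEtTh2009, Prop 5.2 p.324 (PDF p.98); Rmk 4.3.2 p.318–319 (PDF pp.92–93); §5 p.322 (PDF p.96); §5 p.331 (PDF p.105)] -/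
theorem prop52Rows_atLevel_ofThetaSettingFamily
    (hH : ∀ y : (C.thetaEnvTower τ hC hS).PiX, y ∈ (C.thetaEnvTower τ hC hS).PiYdd →
      (ContinuousMulEquiv.refl _) y ∈ (BiKummerSetting.mkOfConnectedTemperoid (C.temperedArithmeticGroup e) tf hZ hP NH A₀ hA₀ hA₀').Hodot)
    (N : ℕ+) :
    ((ofThetaSettingFamily τ hC hS h Q R K' constEmb constEmb_injective hinvc hinvp α β comm_sCap comm_sCup isIsometry_α
        degFr_α isIsometry_β degFr_β baseFrob_α).atLevel N).StrvSection ∧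
    ((ofThetaSettingFamily τ hC hS h Q R K' constEmb constEmb_injective hinvc hinvp α β comm_sCap comm_sCup isIsometry_α
        degFr_α isIsometry_β degFr_β baseFrob_α).atLevel N).IsAutAmple
      ((ofThetaSettingFamily τ hC hS h Q R K' constEmb constEmb_injective hinvc hinvp α β comm_sCap comm_sCup isIsometry_α
        degFr_α isIsometry_β degFr_β baseFrob_α).atLevel N).AN ∧
    ∀ ν : ((ofThetaSettingFamily τ hC hS h Q R K' constEmb constEmb_injective hinvc hinvp α β comm_sCap comm_sCup
            isIsometry_α degFr_α isIsometry_β degFr_β baseFrob_α).atLevel N).lDeltaModN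
          ((ofThetaSettingFamily τ hC hS h Q R K' constEmb constEmb_injective hinvc hinvp α β comm_sCap comm_sCup
            isIsometry_α degFr_α isIsometry_β degFr_β baseFrob_α).atLevel N).BN ≃*
        ((ofThetaSettingFamily τ hC hS h Q R K' constEmb constEmb_injective hinvc hinvp α β comm_sCap comm_sCup
            isIsometry_α degFr_α isIsometry_β degFr_β baseFrob_α).atLevel N).muTorsion
          ((ofThetaSettingFamily τ hC hS h Q R K' constEmb constEmb_injective hinvc hinvp α β comm_sCap comm_sCup
            isIsometry_α degFr_α isIsometry_β degFr_β baseFrob_α).atLevel N).BN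
          ((ofThetaSettingFamily τ hC hS h Q R K' constEmb constEmb_injective hinvc hinvp α β comm_sCap comm_sCup
            isIsometry_α degFr_α isIsometry_β degFr_β baseFrob_α).atLevel N).N,
      ∃ η : ((ofThetaSettingFamily τ hC hS h Q R K' constEmb constEmb_injective hinvc hinvp α β comm_sCap comm_sCup
              isIsometry_α degFr_α isIsometry_β degFr_β baseFrob_α).atLevel N).HB →
          ((ofThetaSettingFamily τ hC hS h Q R K' constEmb constEmb_injective hinvc hinvp α β comm_sCap comm_sCup
              isIsometry_α degFr_α isIsometry_β degFr_β baseFrob_α).atLevel N).lDeltaModN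
            ((ofThetaSettingFamily τ hC hS h Q R K' constEmb constEmb_injective hinvc hinvp α β comm_sCap comm_sCup
              isIsometry_α degFr_α isIsometry_β degFr_β baseFrob_α).atLevel N).BN,
        FrobenioidThetaBiKummer.ThetaPairKummerClass
          ((ofThetaSettingFamily τ hC hS h Q R K' constEmb constEmb_injective hinvc hinvp α β comm_sCap comm_sCup
            isIsometry_α degFr_α isIsometry_β degFr_β baseFrob_α).atLevel N) η ν :=
  prop52Rows_atLevel_ofConnectedTemperoidFamily (𝒯 := C.thetaEnvTower τ hC hS) h Q C.odd_lPNat R (ContinuousMulEquiv.refl _) K'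
    constEmb constEmb_injective hinvc hinvp α β comm_sCap comm_sCup isIsometry_α degFr_α isIsometry_β degFr_β baseFrob_α hH N

end OfThetaSettingFamily

/-! ### At every level of the tower of the Setting with `A_⊙^bs := Ÿ̲̲` (`mkOfConnectedTemperoidYddTower` at `(Π^tp_X̲̲, C.thetaEnvTower τ hC hS, id)`): NO named `Π`-side input -/

section OfThetaSettingYddTower

variable {p : ℕ} [Fact p.Prime] {D : ThetaSetting p} {E : D.EtaleThetaData} {l : ℕ} {C : E.DoubleUnderline l}
  {e : D.toTemperedCurve.GroupLevelData} {Es : Set ℕ+} (τ : D.CyclotomeTower l Es) (hC : D.Compat) (hS : D.Sec2Hyps)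
  {D₀ : Type} [Category.{v₀} D₀] {V : FrdIMonoidStub.{0}} {T₀ : RealifiedDivisorMonoids (D₀ := D₀) V}
  {VD : FrdICatStub.{1, 0, 0} (ConnectedPart (BTemp (C.temperedArithmeticGroup e).Pi))}
  {tf : TemperedFrobenioid T₀ (ConnectedPart (BTemp (C.temperedArithmeticGroup e).Pi)) VD} {hZ : tf.monoidType = MonoidType.Z}
  {hP : ∀ A : (ConnectedPart (BTemp (C.temperedArithmeticGroup e).Pi))ᵒᵖ, IsPerfect (tf.Φ.carrier A)}
  {NH : Subgroup (Field.absoluteGaloisGroup D.K) → tf.category → ℕ+ → Prop}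
  {pullFrac : ∀ {A A' : (BiKummerSetting.mkOfConnectedTemperoidYddTower (C.temperedArithmeticGroup e) tf hZ hP NH
      (C.thetaEnvTower τ hC hS) (ContinuousMulEquiv.refl _)).C} (_ : A' ⟶ A),
    (BiKummerSetting.mkOfConnectedTemperoidYddTower (C.temperedArithmeticGroup e) tf hZ hP NH (C.thetaEnvTower τ hC hS)
        (ContinuousMulEquiv.refl _)).biratUnits A →
      (BiKummerSetting.mkOfConnectedTemperoidYddTower (C.temperedArithmeticGroup e) tf hZ hP NH (C.thetaEnvTower τ hC hS)
        (ContinuousMulEquiv.refl _)).biratUnits A'}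
  {θ : (BiKummerSetting.mkOfConnectedTemperoidYddTower (C.temperedArithmeticGroup e) tf hZ hP NH (C.thetaEnvTower τ hC hS)
      (ContinuousMulEquiv.refl _)).biratUnits
    (BiKummerSetting.mkOfConnectedTemperoidYddTower (C.temperedArithmeticGroup e) tf hZ hP NH (C.thetaEnvTower τ hC hS)
      (ContinuousMulEquiv.refl _)).Aodot}
  {Bl : (BiKummerSetting.mkOfConnectedTemperoidYddTower (C.temperedArithmeticGroup e) tf hZ hP NH (C.thetaEnvTower τ hC hS)
      (ContinuousMulEquiv.refl _)).C}
  {Pl : (BiKummerSetting.mkOfConnectedTemperoidYddTower (C.temperedArithmeticGroup e) tf hZ hP NH (C.thetaEnvTower τ hC hS)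
      (ContinuousMulEquiv.refl _)).FractionPair θ Bl}
  {Rl : (BiKummerSetting.mkOfConnectedTemperoidYddTower (C.temperedArithmeticGroup e) tf hZ hP NH (C.thetaEnvTower τ hC hS)
      (ContinuousMulEquiv.refl _)).NthRoot θ Pl C.lPNat pullFrac}
  (h : ModelFrobenioid.Hypotheses tf.divisorMonoid tf.ratFnFunctor)
  (Q : FrobenioidTheta.ThetaSubquotientStub.{0} (ConnectedPart (BTemp (C.temperedArithmeticGroup e).Pi)))
  (R : ∀ N : ℕ+, (BiKummerSetting.mkOfConnectedTemperoidYddTower (C.temperedArithmeticGroup e) tf hZ hP NH (C.thetaEnvTower τ hC hS)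
      (ContinuousMulEquiv.refl _)).NthRoot Rl.root Rl.pair N pullFrac)
  (K' : Type) [Field K'] (constEmb : ∀ N : ℕ+, K'ˣ →* tf.biratUnitsModel (R N).BN)
  (constEmb_injective : ∀ N : ℕ+, Function.Injective (constEmb N))
  (hinvc : ∀ (N : ℕ+) (g : Aut (R N).AN.base),
    pull tf.divisorMonoid g.hom (ModelFrobenioid.div (R N).pair.num) = ModelFrobenioid.div (R N).pair.num)
  (hinvp : ∀ (N : ℕ+) (y : (C.thetaEnvTower τ hC hS).PiX), y ∈ (C.thetaEnvTower τ hC hS).PiYdd →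
    pull tf.divisorMonoid ((BiKummerSetting.mkOfConnectedTemperoidYddTower (C.temperedArithmeticGroup e) tf hZ hP NH
      (C.thetaEnvTower τ hC hS) (ContinuousMulEquiv.refl _)).galoisSurj (R N).AN.base (R N).αData.isGalois
        ((ContinuousMulEquiv.refl _) y)).hom (ModelFrobenioid.div (R N).pair.den) = ModelFrobenioid.div (R N).pair.den)
  (α : ∀ {N N' : ℕ+}, (N : ℕ) ∣ N' → ((R N').AN ⟶ (R N).AN))
  (β : ∀ {N N' : ℕ+}, (N : ℕ) ∣ N' → ((R N').BN ⟶ (R N).BN))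
  (comm_sCap : ∀ {N N' : ℕ+} (hd : (N : ℕ) ∣ N'), (R N').pair.num ≫ β hd = α hd ≫ (R N).pair.num)
  (comm_sCup : ∀ {N N' : ℕ+} (hd : (N : ℕ) ∣ N'), (R N').pair.den ≫ β hd = α hd ≫ (R N).pair.den)
  (isIsometry_α : ∀ {N N' : ℕ+} (hd : (N : ℕ) ∣ N'),
    ((BiKummerSetting.mkOfConnectedTemperoidYddTower (C.temperedArithmeticGroup e) tf hZ hP NH (C.thetaEnvTower τ hC hS)
      (ContinuousMulEquiv.refl _)).sec5Stub h).pre.IsIsometry (α hd))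
  (degFr_α : ∀ {N N' : ℕ+} (hd : (N : ℕ) ∣ N'),
    (((BiKummerSetting.mkOfConnectedTemperoidYddTower (C.temperedArithmeticGroup e) tf hZ hP NH (C.thetaEnvTower τ hC hS)
      (ContinuousMulEquiv.refl _)).sec5Stub h).pre.degFr (α hd) : ℕ) * N = N')
  (isIsometry_β : ∀ {N N' : ℕ+} (hd : (N : ℕ) ∣ N'),
    ((BiKummerSetting.mkOfConnectedTemperoidYddTower (C.temperedArithmeticGroup e) tf hZ hP NH (C.thetaEnvTower τ hC hS)
      (ContinuousMulEquiv.refl _)).sec5Stub h).pre.IsIsometry (β hd))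
  (degFr_β : ∀ {N N' : ℕ+} (hd : (N : ℕ) ∣ N'),
    (((BiKummerSetting.mkOfConnectedTemperoidYddTower (C.temperedArithmeticGroup e) tf hZ hP NH (C.thetaEnvTower τ hC hS)
      (ContinuousMulEquiv.refl _)).sec5Stub h).pre.degFr (β hd) : ℕ) * N = N')
  (baseFrob_α : ∀ {N N' : ℕ+} (hd : (N : ℕ) ∣ N'),
    (BiKummerSetting.mkOfConnectedTemperoidYddTower (C.temperedArithmeticGroup e) tf hZ hP NH (C.thetaEnvTower τ hC hS)
      (ContinuousMulEquiv.refl _)).IsOfBaseFrobeniusType (α hd))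

/-- **Tranche-126 certificate at EVERY level `N ≥ 1` of the tower of the Setting with `A_⊙^bs := Ÿ̲̲`, NO named `Π`-side input**
(`hH :=` abc-iut-L2-t4's THEOREM `hH_mkOfConnectedTemperoidYddTower` at `(Π^tp_X̲̲, C.thetaEnvTower τ hC hS, id)`): F-0555 `StrvSection`,
"`A_N` is Aut-ample" and F-0558 (`η`-existential, every `ν`) are THEOREMS of the construction data at every level.
[cite: MochizukiEtTh2009, Prop 5.2 p.324 (PDF p.98); Rmk 4.3.2 p.318–319 (PDF pp.92–93); §5 p.322 (PDF p.96); §5 p.331 (PDF p.105)] -/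
theorem prop52Rows_atLevel_ofThetaSettingYddTower (N : ℕ+) :
    ((ofThetaSettingFamily τ hC hS h Q R K' constEmb constEmb_injective hinvc hinvp α β comm_sCap comm_sCup isIsometry_α
        degFr_α isIsometry_β degFr_β baseFrob_α).atLevel N).StrvSection ∧
    ((ofThetaSettingFamily τ hC hS h Q R K' constEmb constEmb_injective hinvc hinvp α β comm_sCap comm_sCup isIsometry_α
        degFr_α isIsometry_β degFr_β baseFrob_α).atLevel N).IsAutAmple
      ((ofThetaSettingFamily τ hC hS h Q R K' constEmb constEmb_injective hinvc hinvp α β comm_sCap comm_sCup isIsometry_α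
        degFr_α isIsometry_β degFr_β baseFrob_α).atLevel N).AN ∧
    ∀ ν : ((ofThetaSettingFamily τ hC hS h Q R K' constEmb constEmb_injective hinvc hinvp α β comm_sCap comm_sCup
            isIsometry_α degFr_α isIsometry_β degFr_β baseFrob_α).atLevel N).lDeltaModN
          ((ofThetaSettingFamily τ hC hS h Q R K' constEmb constEmb_injective hinvc hinvp α β comm_sCap comm_sCup
            isIsometry_α degFr_α isIsometry_β degFr_β baseFrob_α).atLevel N).BN ≃*
        ((ofThetaSettingFamily τ hC hS h Q R K' constEmb constEmb_injective hinvc hinvp α β comm_sCap comm_sCup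
            isIsometry_α degFr_α isIsometry_β degFr_β baseFrob_α).atLevel N).muTorsion
          ((ofThetaSettingFamily τ hC hS h Q R K' constEmb constEmb_injective hinvc hinvp α β comm_sCap comm_sCup
            isIsometry_α degFr_α isIsometry_β degFr_β baseFrob_α).atLevel N).BN
          ((ofThetaSettingFamily τ hC hS h Q R K' constEmb constEmb_injective hinvc hinvp α β comm_sCap comm_sCup
            isIsometry_α degFr_α isIsometry_β degFr_β baseFrob_α).atLevel N).N,
      ∃ η : ((ofThetaSettingFamily τ hC hS h Q R K' constEmb constEmb_injective hinvc hinvp α β comm_sCap comm_sCup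
              isIsometry_α degFr_α isIsometry_β degFr_β baseFrob_α).atLevel N).HB →
          ((ofThetaSettingFamily τ hC hS h Q R K' constEmb constEmb_injective hinvc hinvp α β comm_sCap comm_sCup
              isIsometry_α degFr_α isIsometry_β degFr_β baseFrob_α).atLevel N).lDeltaModN
            ((ofThetaSettingFamily τ hC hS h Q R K' constEmb constEmb_injective hinvc hinvp α β comm_sCap comm_sCup
              isIsometry_α degFr_α isIsometry_β degFr_β baseFrob_α).atLevel N).BN,
        FrobenioidThetaBiKummer.ThetaPairKummerClass
          ((ofThetaSettingFamily τ hC hS h Q R K' constEmb constEmb_injective hinvc hinvp α β comm_sCap comm_sCup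
            isIsometry_α degFr_α isIsometry_β degFr_β baseFrob_α).atLevel N) η ν :=
  prop52Rows_atLevel_ofConnectedTemperoidYddTower h Q C.odd_lPNat R K' constEmb constEmb_injective hinvc hinvp α β comm_sCap
    comm_sCup isIsometry_α degFr_α isIsometry_β degFr_β baseFrob_α N

end OfThetaSettingYddTower

end ThetaFrobenioidTower

end Literature.AnabelianGeometry.EtaleTheta

end
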